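import Mathlib
import Summits.KontsevichZagierPeriods.KontsevichZagierPeriods.Theorems.InverseLandauTateFamilyKernelStubExactDescent
import Summits.KontsevichZagierPeriods.KontsevichZagierPeriods.Theorems.InverseLandauTateFamilyKernelStubExactWall

/-!
# Crux `TateFamilyKernel` (stmt-KontsevichZagierPeriods-9130), line `Sketch` — the EXACT MECHANISM is formal,
walls included

If a Tate family `P/Q` (admissible and identically vanishing on `(0,ε)`) is Griffiths-exact at FAMILY level up to
a scalar `c(ϖ) ∈ ℚ[ϖ] ∖ 0` — `c(ϖ)·P/Q = Σ_k ∂_{i_k}(A_k/D_k)` pointwise on `[0,1]^{N+2} × (0,ε)` with Tate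
admissible `D_k` — then at EVERY real-algebraic `ϖ₀ ∈ (0,ε)`, walls `c(ϖ₀) = 0` included, every tame cube
representation of the fibre is a relation, given the crux in dimension `N + 1` (the induction hypothesis of the
line's skeleton): `stub_exactWall` (p145504: `ϖ`-derivative data at the wall + Tate boundary family via
`stub_derivFamily` p141685 and `stub_boundaryFamily` p137587) + `stub_exactDescent` (p137592).
-/

noncomputable section

open MeasureTheory Set MvPolynomial
open Literature.NumberTheory.Transcendental

namespace Summit.KontsevichZagierPeriods.InverseLandau.TateFamilyKernel.Descent

/-- **Family-level exactness up to a scalar ⇒ relation at every algebraic fibre, walls included** (the exact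
mechanism of the normal form, completely formal in v7's format): `stub_exactWall` + `stub_exactDescent` (p137592)
+ the induction hypothesis of `tameFibreKernel_tate_all` in dimension `N + 1`. [cite: KontsevichZagier2001, §1.2] -/
theorem exactFamily_mem_relations (N K : ℕ) (i : Fin K → Fin (N + 2)) (P Q : MvPolynomial (Fin (N + 2 + 1)) ℚ)
    (A Dn : Fin K → MvPolynomial (Fin (N + 2 + 1)) ℚ) (c : Polynomial ℚ) (ε : ℝ) (hε : 0 < ε)
    (IH : ∀ (P Q : MvPolynomial (Fin (N + 1 + 1)) ℚ) (ε : ℝ), 0 < ε →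
      (∃ c₀ : ℚ, c₀ ≠ 0 ∧ ∀ z : Fin (N + 1) → ℝ,
        aeval (Fin.snoc z (0 : ℝ) : Fin (N + 1 + 1) → ℝ) Q = (c₀ : ℝ)) →
      (∀ (z : Fin (N + 1) → ℝ) (ϖ : ℝ), (∀ t, z t ∈ Icc (0 : ℝ) 1) → ϖ ∈ Ioo 0 ε →
        aeval (Fin.snoc z ϖ : Fin (N + 1 + 1) → ℝ) Q ≠ 0) →
      (∀ ϖ ∈ Ioo (0 : ℝ) ε, ∫ z in Set.pi Set.univ (fun _ : Fin (N + 1) => Ioo (0 : ℝ) 1),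
        aeval (Fin.snoc z ϖ : Fin (N + 1 + 1) → ℝ) P / aeval (Fin.snoc z ϖ : Fin (N + 1 + 1) → ℝ) Q = 0) →
      ∀ ϖ₀ : ℝ, IsAlgebraic ℚ ϖ₀ → ϖ₀ ∈ Ioo 0 ε →
      ∀ Φ : KZ.IntegralRep (N + 1), Φ.IsTameCube →
        (∀ z ∈ KZ.cube (N + 1), Φ.integrand z =
          aeval (Fin.snoc z ϖ₀ : Fin (N + 1 + 1) → ℝ) P / aeval (Fin.snoc z ϖ₀ : Fin (N + 1 + 1) → ℝ) Q) →
        KZ.of Φ ∈ KZ.relations)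
    (hc : c ≠ 0)
    (hTD : ∀ k, ∃ c₀ : ℚ, c₀ ≠ 0 ∧ ∀ w : Fin (N + 2) → ℝ,
      aeval (Fin.snoc w (0 : ℝ) : Fin (N + 2 + 1) → ℝ) (Dn k) = (c₀ : ℝ))
    (hadmD : ∀ k (w : Fin (N + 2) → ℝ) (ϖ : ℝ), (∀ t, w t ∈ Icc (0 : ℝ) 1) → ϖ ∈ Ioo 0 ε →
      aeval (Fin.snoc w ϖ : Fin (N + 2 + 1) → ℝ) (Dn k) ≠ 0)
    (hadmQ : ∀ (w : Fin (N + 2) → ℝ) (ϖ : ℝ), (∀ t, w t ∈ Icc (0 : ℝ) 1) → ϖ ∈ Ioo 0 ε →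
      aeval (Fin.snoc w ϖ : Fin (N + 2 + 1) → ℝ) Q ≠ 0)
    (hvan : ∀ ϖ ∈ Ioo 0 ε, ∫ w in Set.pi Set.univ (fun _ : Fin (N + 2) => Ioo (0 : ℝ) 1),
      aeval (Fin.snoc w ϖ : Fin (N + 2 + 1) → ℝ) P / aeval (Fin.snoc w ϖ : Fin (N + 2 + 1) → ℝ) Q = 0)
    (hexact : ∀ ϖ ∈ Ioo 0 ε, ∀ w ∈ KZ.cube (N + 2),
      (Polynomial.aeval ϖ c : ℝ) *
          (aeval (Fin.snoc w ϖ : Fin (N + 2 + 1) → ℝ) P / aeval (Fin.snoc w ϖ : Fin (N + 2 + 1) → ℝ) Q) =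
        ∑ k, aeval (Fin.snoc w ϖ : Fin (N + 2 + 1) → ℝ)
            (pderiv (Fin.castSucc (i k)) (A k) * Dn k - A k * pderiv (Fin.castSucc (i k)) (Dn k)) /
          aeval (Fin.snoc w ϖ : Fin (N + 2 + 1) → ℝ) (Dn k ^ 2))
    (ϖ₀ : ℝ) (halg : IsAlgebraic ℚ ϖ₀) (hϖ₀ : ϖ₀ ∈ Ioo 0 ε)
    (Φ : KZ.IntegralRep (N + 2)) (hΦ : Φ.IsTameCube)
    (hΦi : ∀ w ∈ KZ.cube (N + 2), Φ.integrand w =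
      aeval (Fin.snoc w ϖ₀ : Fin (N + 2 + 1) → ℝ) P / aeval (Fin.snoc w ϖ₀ : Fin (N + 2 + 1) → ℝ) Q) :
    KZ.of Φ ∈ KZ.relations := by
  obtain ⟨K', i', A', Dn', Pb, Qb, hDn', hbT, hbadm, hbval, hbvan, hfib⟩ :=
    stub_exactWall N K i P Q A Dn c ε hε hc hTD hadmD hadmQ hvan hexact ϖ₀ halg hϖ₀
  exact stub_exactDescent N IH K' i' A' Dn' ε hε ϖ₀ halg hϖ₀ hDn' Pb Qb hbT hbadm hbval hbvan Φ hΦ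
    (fun w hw => by rw [hΦi w hw, hfib w hw])


end Summit.KontsevichZagierPeriods.InverseLandau.TateFamilyKernel.Descent
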